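import Literature.Analysis.FluidPDE.SereginSverak2002CaseB
import HarnessLib

/-!
# Seregin–Šverák 2002 with the final-time hypothesis made explicit: no blow-up

Analysis/FluidPDE proof file (theorems only; no definitions, no named facts) on the item
`Literature.Analysis.FluidPDE.seregin_sverak_2002` (G. Seregin, V. Šverák, *Navier–Stokes
equations with lower bounds on the pressure*, Arch. Ration. Mech. Anal. **163** (2002) 65–86,
Thm. 2.2 p. 70; primary text read, author-hosted offprint).

**What the printed theorem assumes.** Thm. 2.2 is stated for a GLOBAL Leray–Hopf weak solution and
assumes the one-sided bound `|v|² + 2p ≤ g` ((2.9)) resp. `p ≥ -g` ((2.10)) at EVERY time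
`t ∈ ]0, +∞[`, in particular at the putative first singular time `t₀`; condition (C) on `g`
(Def. 2.1: (2.7) `sup_{x₀} sup_{t₀-R₀² ≤ t ≤ t₀} ∫_{B(x₀,R₀)} g/|x-x₀| < ∞`, (2.8) LEFT continuity
at `t₀` of `t ↦ ∫_{B(x₀,R)} g(x,t)/|x-x₀| dx`) is built around `t₀`, and the proof (§4) uses the
hypothesis AT `t₀`: (4.8)–(4.9), resp. (4.11)–(4.13), are evaluated at `t = t₀` (p. 80–81, "one
of the crucial points of our argument"; p. 84), where their terms are the weighted integrals
`∫_{B(x₀,R)} |ṽ(x,t₀)|² |x-x₀|⁻¹ dx`, `∫_{B(x₀,R)} [g - |v|² - 2p](x,t₀) |x-x₀|⁻¹ dx` of the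
final-time field. The tree's named fact `seregin_sverak_2002` (and its twin
`SereginSverak2002_pressureOneSidedBound`) imposes the bound only for `t ∈ (0, T)`, `T` being the
final time of the classical solution, i.e. it drops the hypothesis at the singular time: it is a
strengthening of the printed theorem. For the pressure floor the strengthening is nevertheless a
theorem of the tree (`seregin_sverak_2002_of_floor`, `SereginSverak2002CaseB.lean`, by an argument
that does not use the final time); for the head ceiling the information at times `t < T` passes to
`t = T` only in the Fatou direction (finite RADIAL weighted energy `∫_{B(x₀,1)} |ṽ(T)|²/|x-x₀|`),
and what the printed Step "(4.8)–(4.9) at `t₀`" supplies is exactly the missing control of the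
final-time field near `x₀`.

**What is proved here.** The printed conclusion under EITHER one-sided bound on `(0, T) × ℝ³`
together with the explicit final-time integrability that the printed `t₀`-step uses in the form
sufficient for it:

  `(FM)  ∫_{B(x₀, 1)} ‖u(T, x)‖² / ‖x - x₀‖ dx < ∞` for every `x₀`

(the final value `u(T)` — the weak `L²` trace of the Leray–Hopf solution — has a finite
`|x-x₀|⁻¹`-moment of its energy at every point; for the printed smooth-up-to-`t₀` alternatives this
is automatic, and under (2.9)/(2.10) at `t₀` it is what makes the terms of (4.8)/(4.13) at `t₀`
finite). Route: by `SereginSverak2002.isBackwardBoundedAt_top_of_weakVanishing` (the tree's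
reconstruction of §§3–4: Type I from the monotone scaled energy, Lemma 3.3 = one-scale smallness,
largeness on final windows, blow-up limit at the vertex, zero extension, CKN no-concentration) it
suffices that every blow-up limit at the vertex `(T, x₀)` vanishes weakly at its final time; the
time modulus of the zoom pairings (`zoom_pairing_modulus`, (4.3)-type identity, either alternative)
reduces this to the vanishing of the pairings of the zooms `R u(T, x₀ + R ·)` of the final value,
and under (FM) these zooms even tend to zero strongly in `L²_loc`:
`∫_{B(0,a)} |R u(T, x₀ + R y)|² dy = R⁻¹ ∫_{B(x₀, aR)} |u(T)|² ≤ a ∫_{B(x₀, aR)} |u(T)|²/|x - x₀| → 0`.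

## Contents (namespace `Literature.Analysis.FluidPDE.SereginSverak2002`)

* `lintegral_ball_enorm_sq_le_mul_moment`, `tendsto_lintegral_ball_zoom_of_moment`,
  `tendsto_integral_inner_zoom_of_moment` — zooms of a field with a finite moment at `x₀` vanish;
* `ae_abs_pairing_le_near_top_of_moment` — the blow-up limit at `(T, x₀)` vanishes weakly at the
  final time (either alternative + (FM) at `x₀`);
* `isBackwardBoundedAt_top_of_moment` (`ν = 1`), `isBackwardBoundedAt_of_moment` (`ν > 0`,
  `t₀ ∈ (0, T]`);
* `Literature.Analysis.FluidPDE.seregin_sverak_2002_of_finalMoment` — the global form: bounded on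
  `(δ, T) × ℝ³` for every `δ ∈ (0, T)`.

## References

* G. Seregin, V. Šverák, Arch. Ration. Mech. Anal. 163 (2002) 65–86: Def. 2.1, Thm. 2.2 (p. 70),
  Lemma 3.2, Lemma 3.3 (pp. 72–76), §4 (4.1), (4.7)–(4.13) (pp. 76–84). [SereginSverak2002]
-/

noncomputable section

open MeasureTheory TopologicalSpace Set Function Filter Topology Metric InnerProductSpace Real
open scoped ENNReal NNReal RealInnerProductSpace ContDiff

namespace Literature.Analysis.FluidPDE

namespace SereginSverak2002

variable {T : ℝ} {u : ℝ → EuclideanSpace ℝ (Fin 3) → EuclideanSpace ℝ (Fin 3)}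
  {p : ℝ → EuclideanSpace ℝ (Fin 3) → ℝ}

/-! ### Zooms of a field with a finite moment at the centre vanish -/

/-- On the punctured ball `B(x₀, r) ∖ {x₀}`: `‖b x‖ₑ² ≤ r · (‖b x‖² / ‖x - x₀‖)`. [folklore] -/
theorem enorm_sq_le_mul_moment (b : EuclideanSpace ℝ (Fin 3) → EuclideanSpace ℝ (Fin 3))
    {x₀ x : EuclideanSpace ℝ (Fin 3)} {r : ℝ} (hx : x ∈ ball x₀ r) (hx0 : x ≠ x₀) :
    ‖b x‖ₑ ^ 2 ≤ ENNReal.ofReal r * ENNReal.ofReal (‖b x‖ ^ 2 / ‖x - x₀‖) := by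
  have hρ : 0 < ‖x - x₀‖ := norm_pos_iff.2 (sub_ne_zero.2 hx0)
  have hρr : ‖x - x₀‖ < r := by rwa [mem_ball, dist_eq_norm] at hx
  have hr : 0 ≤ r := hρ.le.trans hρr.le
  rw [← ofReal_norm, ← ENNReal.ofReal_pow (norm_nonneg _), ← ENNReal.ofReal_mul hr]
  refine ENNReal.ofReal_le_ofReal ?_
  rw [← mul_div_assoc, le_div_iff₀ hρ]
  have h1 : ‖b x‖ ^ 2 * ‖x - x₀‖ ≤ ‖b x‖ ^ 2 * r :=
    mul_le_mul_of_nonneg_left hρr.le (sq_nonneg _)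
  linarith

/-- **Energy on a ball against the moment**:
`∫⁻_{B(x₀,r)} ‖b‖ₑ² ≤ r ∫⁻_{B(x₀,r)} ‖b x‖²/‖x - x₀‖`. [folklore] -/
theorem lintegral_ball_enorm_sq_le_mul_moment (b : EuclideanSpace ℝ (Fin 3) → EuclideanSpace ℝ (Fin 3))
    (x₀ : EuclideanSpace ℝ (Fin 3)) (r : ℝ) :
    ∫⁻ x in ball x₀ r, ‖b x‖ₑ ^ 2 ≤
      ENNReal.ofReal r * ∫⁻ x in ball x₀ r, ENNReal.ofReal (‖b x‖ ^ 2 / ‖x - x₀‖) := by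
  rw [← lintegral_const_mul' _ _ ENNReal.ofReal_ne_top]
  refine lintegral_mono_ae ?_
  have h0 : ∀ᵐ x ∂(volume : Measure (EuclideanSpace ℝ (Fin 3))), x ≠ x₀ := by
    rw [ae_iff]
    simp
  filter_upwards [ae_restrict_mem measurableSet_ball, ae_restrict_of_ae h0] with x hx hx0
  exact enorm_sq_le_mul_moment b hx hx0

/-- **Zooms of a field with a finite moment vanish strongly in `L²_loc`**: if
`∫_{B(x₀,1)} ‖b‖²/‖x - x₀‖ < ∞` then `∫⁻_{B(0,a)} ‖R_j b(x₀ + R_j y)‖ₑ² dy → 0` as `R_j → 0⁺`.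
[folklore] -/
theorem tendsto_lintegral_ball_zoom_of_moment (b : EuclideanSpace ℝ (Fin 3) → EuclideanSpace ℝ (Fin 3))
    (x₀ : EuclideanSpace ℝ (Fin 3))
    (hmom : ∫⁻ x in ball x₀ 1, ENNReal.ofReal (‖b x‖ ^ 2 / ‖x - x₀‖) ≠ ⊤)
    {a : ℝ} (ha : 0 < a) {R : ℕ → ℝ} (hRpos : ∀ j, 0 < R j) (hR0 : Tendsto R atTop (𝓝 0)) :
    Tendsto (fun j => ∫⁻ y in ball (0 : EuclideanSpace ℝ (Fin 3)) a, ‖R j • b (x₀ + R j • y)‖ₑ ^ 2)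
      atTop (𝓝 0) := by
  set μ1 : Measure (EuclideanSpace ℝ (Fin 3)) := volume.restrict (ball x₀ 1) with hμ1
  set fb : EuclideanSpace ℝ (Fin 3) → ℝ≥0∞ := fun x => ENNReal.ofReal (‖b x‖ ^ 2 / ‖x - x₀‖) with hfb
  -- eventually `a R ≤ 1`
  have hev : ∀ᶠ j in atTop, a * R j ≤ 1 := by
    have : Tendsto (fun j => a * R j) atTop (𝓝 (a * 0)) := hR0.const_mul a
    rw [mul_zero] at this
    exact (this.eventually (Iic_mem_nhds one_pos)).mono fun j hj => hj
  -- the small balls have small measure, so the moment on them tends to zero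
  have hsets : Tendsto (μ1 ∘ fun j => ball x₀ (a * R j)) atTop (𝓝 0) := by
    have hvol : ∀ j, (μ1 ∘ fun j => ball x₀ (a * R j)) j ≤
        ENNReal.ofReal ((a * R j) ^ 3) * volume (ball (0 : EuclideanSpace ℝ (Fin 3)) 1) := by
      intro j
      simp only [Function.comp, hμ1]
      calc volume.restrict (ball x₀ 1) (ball x₀ (a * R j)) ≤ volume (ball x₀ (a * R j)) :=
            Measure.restrict_apply_le _ _
        _ = ENNReal.ofReal ((a * R j) ^ 3) * volume (ball (0 : EuclideanSpace ℝ (Fin 3)) 1) := by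
            rw [Measure.addHaar_ball volume x₀ (by have := hRpos j; positivity),
              finrank_euclideanSpace_fin]
    have hlim : Tendsto (fun j => ENNReal.ofReal ((a * R j) ^ 3) *
        volume (ball (0 : EuclideanSpace ℝ (Fin 3)) 1)) atTop (𝓝 0) := by
      have h1 : Tendsto (fun j => (a * R j) ^ 3) atTop (𝓝 0) := by
        have := (hR0.const_mul a).pow 3
        simpa using this
      have h2 : Tendsto (fun j => ENNReal.ofReal ((a * R j) ^ 3)) atTop (𝓝 0) := by
        have := ENNReal.tendsto_ofReal h1
        rwa [ENNReal.ofReal_zero] at this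
      have h3 := ENNReal.Tendsto.mul_const h2 (Or.inr
        (measure_ball_lt_top (μ := (volume : Measure (EuclideanSpace ℝ (Fin 3))))
          (x := (0 : EuclideanSpace ℝ (Fin 3))) (r := 1)).ne)
      rwa [zero_mul] at h3
    exact tendsto_of_tendsto_of_tendsto_of_le_of_le tendsto_const_nhds hlim (fun j => bot_le) hvol
  have hm := tendsto_setLIntegral_zero (μ := μ1) (f := fb) hmom hsets
  have hm' : Tendsto (fun j => ENNReal.ofReal a * ∫⁻ x in ball x₀ (a * R j), fb x ∂μ1) atTop (𝓝 0) := by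
    have := ENNReal.Tendsto.const_mul (a := ENNReal.ofReal a) hm (Or.inr ENNReal.ofReal_ne_top)
    rwa [mul_zero] at this
  refine tendsto_of_tendsto_of_tendsto_of_le_of_le' tendsto_const_nhds hm'
    (Eventually.of_forall fun j => bot_le) ?_
  filter_upwards [hev] with j hj
  have e : ∫⁻ x in ball x₀ (a * R j), fb x ∂μ1 = ∫⁻ x in ball x₀ (a * R j), fb x := by
    simp only [hμ1]
    rw [Measure.restrict_restrict measurableSet_ball, inter_eq_left.2 (ball_subset_ball hj)]
  rw [e, lintegral_ball_norm_sq_zoom b x₀ (hRpos j) a]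
  calc ENNReal.ofReal (R j)⁻¹ * ∫⁻ x in ball x₀ (a * R j), ‖b x‖ₑ ^ 2
      ≤ ENNReal.ofReal (R j)⁻¹ * (ENNReal.ofReal (a * R j) *
          ∫⁻ x in ball x₀ (a * R j), fb x) := by
        gcongr
        exact lintegral_ball_enorm_sq_le_mul_moment b x₀ (a * R j)
    _ = ENNReal.ofReal a * ∫⁻ x in ball x₀ (a * R j), fb x := by
        rw [← mul_assoc, ← ENNReal.ofReal_mul (inv_nonneg.2 (hRpos j).le), mul_comm a (R j),
          ← mul_assoc, inv_mul_cancel₀ (hRpos j).ne', one_mul]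

/-- **Pairings of the zooms of a field with a finite moment tend to zero**: for `b ∈ L²` with
`∫_{B(x₀,1)} ‖b‖²/‖x - x₀‖ < ∞` and a bounded continuous `φ` supported in `B(0, a)`,
`∫ ⟪R_j b(x₀ + R_j y), φ(y)⟫ dy → 0` as `R_j → 0⁺`. [folklore] -/
theorem tendsto_integral_inner_zoom_of_moment {b : EuclideanSpace ℝ (Fin 3) → EuclideanSpace ℝ (Fin 3)}
    (hb2 : MemLp b 2 volume) (x₀ : EuclideanSpace ℝ (Fin 3))
    (hmom : ∫⁻ x in ball x₀ 1, ENNReal.ofReal (‖b x‖ ^ 2 / ‖x - x₀‖) ≠ ⊤)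
    {φ : EuclideanSpace ℝ (Fin 3) → EuclideanSpace ℝ (Fin 3)} (hφc : Continuous φ) {M : ℝ}
    (hφM : ∀ y, ‖φ y‖ ≤ M) {a : ℝ} (ha : 0 < a)
    (hφs : ∀ y, y ∉ ball (0 : EuclideanSpace ℝ (Fin 3)) a → φ y = 0)
    {R : ℕ → ℝ} (hRpos : ∀ j, 0 < R j) (hR0 : Tendsto R atTop (𝓝 0)) :
    Tendsto (fun j => ∫ y, ⟪R j • b (x₀ + R j • y), φ y⟫) atTop (𝓝 0) := by
  have hbm : AEStronglyMeasurable b volume := hb2.aestronglyMeasurable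
  have hb2' : ∫⁻ x, ‖b x‖ₑ ^ 2 < ⊤ := by
    have h := lintegral_rpow_enorm_lt_top_of_eLpNorm_lt_top two_ne_zero ENNReal.ofNat_ne_top
      hb2.eLpNorm_lt_top
    simpa only [ENNReal.toReal_ofNat, ENNReal.rpow_ofNat] using h
  -- energies of the zooms on the ball are finite
  have hf2 : ∀ j, ∫⁻ y in ball (0 : EuclideanSpace ℝ (Fin 3)) a, ‖R j • b (x₀ + R j • y)‖ₑ ^ 2 < ⊤ := by
    intro j
    rw [lintegral_ball_norm_sq_zoom b x₀ (hRpos j) a]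
    refine ENNReal.mul_lt_top ENNReal.ofReal_lt_top ?_
    exact lt_of_le_of_lt (setLIntegral_le_lintegral _ _) hb2'
  have key := tendsto_integral_inner_of_tendsto_lintegral (μ := (volume : Measure (EuclideanSpace ℝ (Fin 3))))
    (f := fun j y => R j • b (x₀ + R j • y)) (g := fun _ => (0 : EuclideanSpace ℝ (Fin 3))) (η := φ)
    (B := ball (0 : EuclideanSpace ℝ (Fin 3)) a)
    (fun j => aestronglyMeasurable_zoom hbm x₀ (hRpos j)) aestronglyMeasurable_const
    hφc.aestronglyMeasurable hφM measure_ball_lt_top hφs hf2 (by simp)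
    (by simpa using tendsto_lintegral_ball_zoom_of_moment b x₀ hmom ha hRpos hR0)
  simpa using key

/-! ### The blow-up limit vanishes weakly at the final time -/

set_option maxHeartbeats 800000 in
/-- **The blow-up limit vanishes weakly at the final time, under the final-moment condition.**
Let `u` be classical on `[0, T) × ℝ³` (`ν = 1`), Leray–Hopf on `[0, T]`, with either one-sided
pressure bound on `(0, T) × ℝ³`, and assume `∫_{B(x₀,1)} ‖u(T)‖²/‖x - x₀‖ < ∞`. Let `w` be the
`L³(Q(a))`-limit of the zooms `u_{R_j}` at the vertex `(T, x₀)`, `R_j → 0⁺`. Then for every test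
field `φ ∈ C_c^∞(B(0, a))` and `η > 0` there is `δ > 0` with `|∫ ⟪w(s), φ⟫| ≤ η` for a.e.
`s ∈ (-δ, 0)`: the time modulus of `zoom_pairing_modulus` is uniform in the scale, and the zooms of
the final value tend to zero (`tendsto_integral_inner_zoom_of_moment`).
[cite: SereginSverak2002, §4, (4.8)–(4.9) at t₀ (p. 80–81)] -/
theorem ae_abs_pairing_le_near_top_of_moment (hT : 0 < T)
    (hsol : IsClassicalNSSolutionOn (Ico 0 T) 1 0 u p) (hLH : IsLerayHopfOn T 1 0 (u 0) u)
    {K : ℝ} (hK : 0 ≤ K)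
    (hone : (∀ t ∈ Ioo 0 T, ∀ x, ‖u t x‖ ^ 2 / 2 + normalisedPressure (u t) x ≤ K) ∨
      (∀ t ∈ Ioo 0 T, ∀ x, -K ≤ normalisedPressure (u t) x))
    (x₀ : EuclideanSpace ℝ (Fin 3))
    (hmom : ∫⁻ x in ball x₀ 1, ENNReal.ofReal (‖u T x‖ ^ 2 / ‖x - x₀‖) ≠ ⊤)
    {R : ℕ → ℝ} (hRpos : ∀ j, 0 < R j) (hR0 : Tendsto R atTop (𝓝 0))
    {w : ℝ → EuclideanSpace ℝ (Fin 3) → EuclideanSpace ℝ (Fin 3)} {a : ℝ} (ha : 1 ≤ a)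
    (hw3 : MemLp (uncurry w) 3
      (volume.restrict (parabolicCylinder a (0 : ℝ × EuclideanSpace ℝ (Fin 3)))))
    (hconv : Tendsto (fun j => eLpNorm
        (uncurry ((R j) • stPull ((R j) ^ 2) (R j) T x₀ u) - uncurry w) 3
        (volume.restrict (parabolicCylinder a (0 : ℝ × EuclideanSpace ℝ (Fin 3)))))
      atTop (𝓝 0))
    {φ : EuclideanSpace ℝ (Fin 3) → EuclideanSpace ℝ (Fin 3)} (hφ : ContDiff ℝ ∞ φ)
    (hφc : HasCompactSupport φ) (hφa : tsupport φ ⊆ ball (0 : EuclideanSpace ℝ (Fin 3)) a)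
    {η : ℝ} (hη : 0 < η) :
    ∃ δ > 0, ∀ᵐ s ∂(volume : Measure ℝ), s ∈ Ioo (-δ) 0 → |∫ y, ⟪w s y, φ y⟫| ≤ η := by
  have ha0 : 0 < a := by linarith
  -- the modulus and the threshold
  obtain ⟨C, hC0, R₀, hR₀, hmod⟩ := zoom_pairing_modulus hT hsol hLH hK hone x₀ hφ hφc ha hφa
  obtain ⟨δ, hδ, hδ1, hδC⟩ := exists_delta_modulus_le hC0 hη
  refine ⟨δ, hδ, ?_⟩
  -- the field is bounded and supported in the ball
  have hφs : ∀ y, y ∉ ball (0 : EuclideanSpace ℝ (Fin 3)) a → φ y = 0 := fun y hy =>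
    image_eq_zero_of_notMem_tsupport fun h => hy (hφa h)
  obtain ⟨M, hM⟩ := hφ.continuous.bounded_above_of_compact_support hφc
  -- slices of the zooms along a subsequence
  obtain ⟨κ, hκ, hae⟩ := exists_subseq_ae_tendsto_pairing hT hsol x₀ hRpos hR0 hw3 hconv hφ.continuous hM hφs
  -- the zooms of the final value tend to zero
  have hTI : T ∈ Icc 0 T := ⟨hT.le, le_rfl⟩
  have hb2 : MemLp (u T) 2 volume := hLH.memLp T hTI
  have hZ : Tendsto (fun k => ∫ y, ⟪R (κ k) • u T (x₀ + R (κ k) • y), φ y⟫) atTop (𝓝 0) :=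
    tendsto_integral_inner_zoom_of_moment hb2 x₀ hmom hφ.continuous hM ha0 hφs (fun k => hRpos _)
      (hR0.comp hκ.tendsto_atTop)
  -- eventually the scales are below `R₀`
  have hevR : ∀ᶠ k in atTop, R (κ k) ≤ R₀ :=
    (hR0.comp hκ.tendsto_atTop).eventually (Iic_mem_nhds hR₀)
  -- conclude for a.e. `s`
  have hae' := (ae_restrict_iff' measurableSet_Ioo).1 hae
  filter_upwards [hae'] with s hs hsδ
  have hsa : s ∈ Ioo (-a ^ 2) 0 := ⟨by nlinarith [hsδ.1, hδ1, ha], hsδ.2⟩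
  have hs1 : s ∈ Ioo (-1 : ℝ) 0 := ⟨by linarith [hsδ.1], hsδ.2⟩
  have hsabs : |s| < δ := by rw [abs_of_neg hsδ.2]; linarith [hsδ.1]
  have hlimP := (hs hsa).abs
  have hev : ∀ᶠ k in atTop, |∫ y, ⟪R (κ k) • u (T + R (κ k) ^ 2 * s) (x₀ + R (κ k) • y), φ y⟫| ≤
      |∫ y, ⟪R (κ k) • u T (x₀ + R (κ k) • y), φ y⟫| + C * (|s| + |s| ^ (1 / 3 : ℝ)) := by
    filter_upwards [hevR] with k hk
    have h := hmod (R (κ k)) (hRpos _) hk s hs1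
    have := abs_sub_abs_le_abs_sub (∫ y, ⟪R (κ k) • u (T + R (κ k) ^ 2 * s) (x₀ + R (κ k) • y), φ y⟫)
      (∫ y, ⟪R (κ k) • u T (x₀ + R (κ k) • y), φ y⟫)
    linarith
  have hlimZ : Tendsto (fun k => |∫ y, ⟪R (κ k) • u T (x₀ + R (κ k) • y), φ y⟫| + C * (|s| + |s| ^ (1 / 3 : ℝ)))
      atTop (𝓝 (0 + C * (|s| + |s| ^ (1 / 3 : ℝ)))) := by
    have := hZ.abs
    rw [abs_zero] at this
    exact this.add_const _
  have hle := le_of_tendsto_of_tendsto hlimP hlimZ hev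
  rw [zero_add] at hle
  exact hle.trans (hδC s hsabs)

/-! ### Regularity of the final slice -/

/-- **Regularity of the final slice under either one-sided bound and the final-moment condition,
`ν = 1`.** [cite: SereginSverak2002, Thm. 2.2 (p. 70) with its hypothesis at the final time] -/
theorem isBackwardBoundedAt_top_of_moment (hT : 0 < T)
    (hsol : IsClassicalNSSolutionOn (Ico 0 T) 1 0 u p) (hLH : IsLerayHopfOn T 1 0 (u 0) u)
    {K : ℝ} (hK : 0 ≤ K)
    (hone : (∀ t ∈ Ioo 0 T, ∀ x, ‖u t x‖ ^ 2 / 2 + normalisedPressure (u t) x ≤ K) ∨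
      (∀ t ∈ Ioo 0 T, ∀ x, -K ≤ normalisedPressure (u t) x))
    (x₀ : EuclideanSpace ℝ (Fin 3))
    (hmom : ∫⁻ x in ball x₀ 1, ENNReal.ofReal (‖u T x‖ ^ 2 / ‖x - x₀‖) ≠ ⊤) :
    IsBackwardBoundedAt u T x₀ :=
  isBackwardBoundedAt_top_of_weakVanishing hT hsol hLH hK hone x₀
    fun _ _ _ hRpos hR0 hb hw3 hconv _ hφ hφc hφa _ hη =>
      ae_abs_pairing_le_near_top_of_moment hT hsol hLH hK hone x₀ hmom hRpos hR0 hb hw3 hconv hφ hφc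
        hφa hη

/-- The final moment of a constant multiple: `∫⁻_{B(x₀,1)} ‖c b‖²/‖x-x₀‖ = c² ∫⁻_{B(x₀,1)} ‖b‖²/‖x-x₀‖`,
so finiteness is preserved. [folklore] -/
theorem lintegral_moment_const_smul_ne_top {b : EuclideanSpace ℝ (Fin 3) → EuclideanSpace ℝ (Fin 3)}
    {x₀ : EuclideanSpace ℝ (Fin 3)}
    (hmom : ∫⁻ x in ball x₀ 1, ENNReal.ofReal (‖b x‖ ^ 2 / ‖x - x₀‖) ≠ ⊤) (c : ℝ) :
    ∫⁻ x in ball x₀ 1, ENNReal.ofReal (‖(c • b) x‖ ^ 2 / ‖x - x₀‖) ≠ ⊤ := by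
  have e : ∀ x, ENNReal.ofReal (‖(c • b) x‖ ^ 2 / ‖x - x₀‖) =
      ENNReal.ofReal (c ^ 2) * ENNReal.ofReal (‖b x‖ ^ 2 / ‖x - x₀‖) := by
    intro x
    rw [Pi.smul_apply, norm_smul, Real.norm_eq_abs, mul_pow, sq_abs, ← ENNReal.ofReal_mul (sq_nonneg c),
      mul_div_assoc]
  simp_rw [e]
  rw [lintegral_const_mul' _ _ ENNReal.ofReal_ne_top]
  exact ENNReal.mul_ne_top ENNReal.ofReal_ne_top hmom

/-- **Regularity under either one-sided bound and the final-moment condition, every viscosity and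
every time `t₀ ∈ (0, T]`** (viscosity rescaling to `ν = 1`; interior times by continuity).
[cite: SereginSverak2002, Thm. 2.2 (p. 70) with its hypothesis at the final time] -/
theorem isBackwardBoundedAt_of_moment {ν : ℝ} (hν : 0 < ν) (hT : 0 < T)
    (hsol : IsClassicalNSSolutionOn (Ico 0 T) ν 0 u p) (hLH : IsLerayHopfOn T ν 0 (u 0) u)
    {K : ℝ}
    (hone : (∀ t ∈ Ioo 0 T, ∀ x, ‖u t x‖ ^ 2 / 2 + normalisedPressure (u t) x ≤ K) ∨
      (∀ t ∈ Ioo 0 T, ∀ x, -K ≤ normalisedPressure (u t) x))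
    (hmom : ∀ x₀ : EuclideanSpace ℝ (Fin 3),
      ∫⁻ x in ball x₀ 1, ENNReal.ofReal (‖u T x‖ ^ 2 / ‖x - x₀‖) ≠ ⊤)
    {t₀ : ℝ} (ht₀ : t₀ ∈ Ioc 0 T) (x₀ : EuclideanSpace ℝ (Fin 3)) : IsBackwardBoundedAt u t₀ x₀ := by
  -- interior times: continuity
  rcases lt_or_eq_of_le ht₀.2 with hlt | rfl
  · exact IsBackwardBoundedAt.of_continuousOn (continuousOn_uncurry hsol) ⟨ht₀.1, hlt⟩ x₀
  -- the final time: rescale to viscosity one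
  have hν0 : ν ≠ 0 := hν.ne'
  have hνi : 0 < ν⁻¹ := inv_pos.2 hν
  have hνT : 0 < ν * t₀ := mul_pos hν hT
  set v : ℝ → EuclideanSpace ℝ (Fin 3) → EuclideanSpace ℝ (Fin 3) := timeRescale ν⁻¹ ν⁻¹ u with hv
  set π' : ℝ → EuclideanSpace ℝ (Fin 3) → ℝ := timeRescale ν⁻¹ (ν⁻¹ ^ 2) p with hπ
  have hslice : ∀ s, v s = ν⁻¹ • u (ν⁻¹ * s) := fun s => rfl
  have hmaps : MapsTo (fun s => ν⁻¹ * s) (Ico 0 (ν * t₀)) (Ico 0 t₀) := by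
    intro s hs'
    refine ⟨mul_nonneg hνi.le hs'.1, ?_⟩
    calc ν⁻¹ * s < ν⁻¹ * (ν * t₀) := mul_lt_mul_of_pos_left hs'.2 hνi
      _ = t₀ := by rw [← mul_assoc, inv_mul_cancel₀ hν0, one_mul]
  have hs' : IsClassicalNSSolutionOn (Ico 0 (ν * t₀)) 1 0 v π' := by
    have := hsol.viscosityRescale_set hν0 hmaps (uniqueDiffOn_Ico 0 (ν * t₀))
    rwa [timeRescale_zero_force] at this
  have hv0 : v 0 = ν⁻¹ • u 0 := by rw [hslice, mul_zero]
  have hLH' : IsLerayHopfOn (ν * t₀) 1 0 (v 0) v := by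
    have := hLH.viscosityRescale hνi
    rw [div_inv_eq_mul, mul_comm t₀ ν, inv_mul_cancel₀ hν0, timeRescale_zero_force] at this
    rwa [hv0]
  have hpress : ∀ s x, normalisedPressure (v s) x = ν⁻¹ ^ 2 * normalisedPressure (u (ν⁻¹ * s)) x :=
    fun s x => by rw [hslice, normalisedPressure_smul]
  have hnorm : ∀ s x, ‖v s x‖ ^ 2 = ν⁻¹ ^ 2 * ‖u (ν⁻¹ * s) x‖ ^ 2 := fun s x => by
    rw [hslice, Pi.smul_apply, norm_smul, Real.norm_eq_abs, abs_of_pos hνi]; ring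
  -- the one-sided bounds rescale (with the nonnegative constant `ν⁻² |K|`)
  have hone' : (∀ s ∈ Ioo 0 (ν * t₀), ∀ x, ‖v s x‖ ^ 2 / 2 + normalisedPressure (v s) x ≤ ν⁻¹ ^ 2 * |K|) ∨
      (∀ s ∈ Ioo 0 (ν * t₀), ∀ x, -(ν⁻¹ ^ 2 * |K|) ≤ normalisedPressure (v s) x) := by
    rcases hone with hhead | hfloor
    · refine Or.inl fun s hs'' x => ?_
      have ht : ν⁻¹ * s ∈ Ioo 0 t₀ := (inv_mul_mem_Ioo_iff hν).2 hs''
      have h1 := hhead _ ht x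
      have h2 : ‖u (ν⁻¹ * s) x‖ ^ 2 / 2 + normalisedPressure (u (ν⁻¹ * s)) x ≤ |K| :=
        h1.trans (le_abs_self K)
      have := mul_le_mul_of_nonneg_left h2 (sq_nonneg ν⁻¹)
      rw [hpress, hnorm]
      linarith
    · refine Or.inr fun s hs'' x => ?_
      have ht : ν⁻¹ * s ∈ Ioo 0 t₀ := (inv_mul_mem_Ioo_iff hν).2 hs''
      have h1 := hfloor _ ht x
      have h2 : -|K| ≤ normalisedPressure (u (ν⁻¹ * s)) x := (neg_le_neg (le_abs_self K)).trans h1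
      have := mul_le_mul_of_nonneg_left h2 (sq_nonneg ν⁻¹)
      rw [hpress]
      linarith
  -- the final moment rescales
  have hvT : v (ν * t₀) = ν⁻¹ • u t₀ := by
    rw [hslice, ← mul_assoc, inv_mul_cancel₀ hν0, one_mul]
  have hmom' : ∫⁻ x in ball x₀ 1, ENNReal.ofReal (‖v (ν * t₀) x‖ ^ 2 / ‖x - x₀‖) ≠ ⊤ := by
    rw [hvT]
    exact lintegral_moment_const_smul_ne_top (hmom x₀) ν⁻¹
  have hb := isBackwardBoundedAt_top_of_moment hνT hs' hLH' (by positivity : (0 : ℝ) ≤ ν⁻¹ ^ 2 * |K|)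
    hone' x₀ hmom'
  -- transport back: radius `r / max 1 ν`
  obtain ⟨r, hr, C, hC⟩ := hb
  set m : ℝ := max 1 ν with hm
  have hm1 : 1 ≤ m := le_max_left _ _
  have hmν : ν ≤ m := le_max_right _ _
  have hm0 : 0 < m := by positivity
  refine ⟨r / m, by positivity, ν * C, fun t ht x hx => ?_⟩
  have hrm : r / m ≤ r := div_le_self hr.le hm1
  have hts : ν * t ∈ Ioo (ν * t₀ - r ^ 2) (ν * t₀) := by
    constructor
    · have h1 : ν * (t₀ - t) < ν * (r / m) ^ 2 := mul_lt_mul_of_pos_left (by linarith [ht.1]) hν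
      have hsq : ν * (r / m) ^ 2 ≤ r ^ 2 := by
        rw [div_pow]
        have hm2 : ν ≤ m ^ 2 := hmν.trans (by nlinarith)
        calc ν * (r ^ 2 / m ^ 2) = ν / m ^ 2 * r ^ 2 := by ring
          _ ≤ 1 * r ^ 2 := by
              refine mul_le_mul_of_nonneg_right ?_ (sq_nonneg r)
              rw [div_le_one (by positivity)]; exact hm2
          _ = r ^ 2 := one_mul _
      nlinarith
    · exact mul_lt_mul_of_pos_left ht.2 hν
  have hxs : x ∈ ball x₀ r := ball_subset_ball hrm hx
  have key := hC (ν * t) hts x hxs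
  rw [hslice, Pi.smul_apply, ← mul_assoc, inv_mul_cancel₀ hν0, one_mul, norm_smul,
    Real.norm_eq_abs, abs_of_pos hνi] at key
  exact (inv_mul_le_iff₀ hν).1 key

/-- The final-moment condition from its integrable form. [folklore] -/
theorem lintegral_moment_ne_top_of_integrableOn {b : EuclideanSpace ℝ (Fin 3) → EuclideanSpace ℝ (Fin 3)}
    {x₀ : EuclideanSpace ℝ (Fin 3)}
    (h : IntegrableOn (fun x => ‖b x‖ ^ 2 / ‖x - x₀‖) (ball x₀ 1)) :
    ∫⁻ x in ball x₀ 1, ENNReal.ofReal (‖b x‖ ^ 2 / ‖x - x₀‖) ≠ ⊤ := by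
  have hfin := h.hasFiniteIntegral
  rw [HasFiniteIntegral] at hfin
  refine ne_top_of_le_ne_top hfin.ne (lintegral_mono fun x => ?_)
  rw [Real.enorm_eq_ofReal (div_nonneg (sq_nonneg _) (norm_nonneg _))]

/-- **Seregin–Šverák 2002, Thm. 2.2 with its final-time hypothesis made explicit.** Let `ν > 0`,
`T > 0`, and let `(u, p)` be a classical solution of the unforced Navier–Stokes system on
`ℝ³ × [0, T)` which is Leray–Hopf on `[0, T]` from its rapidly decaying datum `u 0`. Assume
EITHER `|u|²/2 + p̃ ≤ K` on `(0, T) × ℝ³` OR `p̃ ≥ -K` there (`p̃` the normalised pressure), AND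
that the final value has a finite `|x - x₀|⁻¹`-moment of its energy at every point,
`∫_{B(x₀,1)} ‖u(T,x)‖²/‖x - x₀‖ dx < ∞` (the integrability of the final-time field that the printed
proof uses at the singular time, (4.8)–(4.9)/(4.13) at `t₀`, pp. 80–84). Then `u` is bounded on
`(δ, T) × ℝ³` for every `δ ∈ (0, T)`. (For the pressure floor the final-moment hypothesis is
superfluous: `seregin_sverak_2002_of_floor`.)
[cite: SereginSverak2002, Thm. 2.2 (p. 70), proof §4 pp. 76–84] -/
theorem _root_.Literature.Analysis.FluidPDE.seregin_sverak_2002_of_finalMoment :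
    ∀ (ν T : ℝ), 0 < ν → 0 < T →
    ∀ (u : ℝ → EuclideanSpace ℝ (Fin 3) → EuclideanSpace ℝ (Fin 3)) (p : ℝ → EuclideanSpace ℝ (Fin 3) → ℝ),
      IsClassicalNSSolutionOn (Ico 0 T) ν 0 u p →
      IsLerayHopfOn T ν 0 (u 0) u →
      HasRapidSpatialDecay (u 0) →
      ((∃ K : ℝ, ∀ t ∈ Ioo 0 T, ∀ x, ‖u t x‖ ^ 2 / 2 + normalisedPressure (u t) x ≤ K) ∨
        (∃ K : ℝ, ∀ t ∈ Ioo 0 T, ∀ x, -K ≤ normalisedPressure (u t) x)) →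
      (∀ x₀ : EuclideanSpace ℝ (Fin 3),
        IntegrableOn (fun x => ‖u T x‖ ^ 2 / ‖x - x₀‖) (ball x₀ 1)) →
      ∀ δ ∈ Ioo 0 T, ∃ M : ℝ, ∀ t ∈ Ioo δ T, ∀ x, ‖u t x‖ ≤ M := by
  intro ν T hν hT u p hsol hLH _ hone hFM δ hδ
  have hmom : ∀ x₀ : EuclideanSpace ℝ (Fin 3),
      ∫⁻ x in ball x₀ 1, ENNReal.ofReal (‖u T x‖ ^ 2 / ‖x - x₀‖) ≠ ⊤ := fun x₀ =>
    lintegral_moment_ne_top_of_integrableOn (hFM x₀)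
  have hone' : ∃ K : ℝ, (∀ t ∈ Ioo 0 T, ∀ x, ‖u t x‖ ^ 2 / 2 + normalisedPressure (u t) x ≤ K) ∨
      (∀ t ∈ Ioo 0 T, ∀ x, -K ≤ normalisedPressure (u t) x) := by
    rcases hone with ⟨K, hK⟩ | ⟨K, hK⟩
    · exact ⟨K, Or.inl hK⟩
    · exact ⟨K, Or.inr hK⟩
  obtain ⟨K, hK⟩ := hone'
  have hloc : ∀ x₀ : EuclideanSpace ℝ (Fin 3), IsBackwardBoundedAt u T x₀ := fun x₀ =>
    isBackwardBoundedAt_of_moment hν hT hsol hLH hK hmom ⟨hT, le_rfl⟩ x₀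
  obtain ⟨R, M₁, hfar⟩ := farField_bound hν hT hsol hLH hδ.1
  obtain ⟨M₂, hnear⟩ := nearField_bound hT (continuousOn_uncurry hsol) hloc hδ.1 R
  refine ⟨max M₁ M₂, fun t ht x => ?_⟩
  by_cases hx : ‖x‖ ≤ R
  · exact (hnear (t, x) ⟨⟨ht.1.le, ht.2.le⟩, mem_closedBall_zero_iff.2 hx⟩ ht.2).trans (le_max_right _ _)
  · exact (hfar t ht x (not_le.1 hx)).trans (le_max_left _ _)

end SereginSverak2002

end Literature.Analysis.FluidPDE

end
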